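/-
Copyright (c) 2026 the pub-hodgecm-mathlib formalisation cell (harness21).  Prover seat hodgecm-mathlib-K2E3-p36 (g3), HCML Track B «K2-LIT» ∕ h413
(`stmt-HodgeConjecture-24833`), R90-TF section S3, (U3-F) assembly at the prime `2`, brick C3 «DYADIC PLACES READ-BACK₂» (dealer R90-C12-plan (g3)
DEAL S3-p36⁗ 01:48:10Z (5); template ★ B7 `R90S3PlantedRootsAndPlaces` (K2E4-p14)).  2026-09-05.
-/
import Summits.HodgeConjecture.HodgeConjecture.Theorems.R90S3PlantedRootsAndPlaces   -- ★ B7 (K2E4-p14): §1 service lemmas + all of B7's ★ imports (P1, P2″, P5, P9′, `CompletionLocalDegree`)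
import Summits.HodgeConjecture.HodgeConjecture.Theorems.R90S3PlantedDyadicData      -- ★ P8d (K2E3-p21): `valuation_sub_one_div_four_le_one_of_pinned`
import HarnessLib

/-!
# R90-TF · S3 · THEOREMS — `R90S3PlantedDyadicPlacesTwo` ((U3-F) assembly at `p = 2`, brick C3): THE PLANTED PLACE `v′`, the unit clause `α ∉ 𝔭_u (u ≠ v′)`,
# AND `α ≡ 1 (mod 4)` AT EVERY DYADIC PLACE `u ≠ v′`

R90-TF section S3 (dealer R90-C12-plan (g3)); crux H413 (`stmt-HodgeConjecture-24833`, lane `--supports … --as helper`), route `HCCMUnconditional`.  The `p := 2`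
twin of ★ B7 `exists_plantedPlace` with B7's binder spine verbatim at `p := 2` PLUS `hc4 : ∀ i, 4 ∣ c′ᵢ − 1`, and B7's conclusion PLUS, inside the `∃ v′`,
the clause `∀ u ≠ v′, 2 ∈ 𝔭_u → |(α − 1)∕4|_u ≤ 1` in the bytes of ★ P8d §2 (`exists_planted_dyadic_data`'s `hα4`), so that the `p = 2` FINAL of the (U3-F)
assembly calls C3 INSTEAD of B7.  INPUT: `K = L_w` (`2 ∈ 𝔭_w`, continuous finite `ℚ₂`-structure of degree `d₀`); a number field `F` with `α ∈ 𝓞 F`,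
`[F : ℚ] = d₀ + r`, `|N_{F∕ℚ}(α)| = 2^a`; `J₀ : F → K` with `J₀ α = β`, `ℚ₂⟮β⟯ = ⊤`, `v_w(β) < 1`; `Jᵢ : F → ℚ₂` with `Jᵢ α = c′ᵢ`, DISTINCT UNITS `c′ᵢ ≡ 1 (mod 4)`
(★ B6 at `p = 2` + ★ `exists_localTarget_forall_two` + §1 below).  OUTPUT (**`exists_plantedPlace_two`**): B7's `DenseRange J₀`, the pinned place `v′ ∋ 2, α`,
`α ∉ 𝔭_u` for `u ≠ v′`, AND `|(α − 1)∕4|_u ≤ 1` for every dyadic `u ≠ v′`.  ★-only imports; THEOREMS ONLY (no `def`, no `instance`, no notation, no named fact,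
no `sorry`); never imports `Cruxes/…/Lines`.  ★ B7 stays frozen (S3-R26): its place-exhaustion block is RE-DERIVED here (≈ 90 l. duplicated, accepted by the
dealer), because B7's conclusion does not export the pins of the places `Uᵢ`.

THE MATHEMATICS [Neukirch, ANT, Ch. II (8.1)–(8.5); Cassels–Fröhlich Ch. II §10; Serre, *Local Fields*, Ch. II §3].  As in ★ B7: `J₀` is dense (★ P2″) and
pins `v′` (★ P1); the `Jᵢ`, read in the `(2)`-adic completion `ℚ_{v₀}` of `ℚ` through Mathlib's `Padic.adicCompletionEquiv =: E`, are dense and pin places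
`Uᵢ ∋ 2` with `α ∉ 𝔭_{Uᵢ}` and local degree `1`; with `e′f′(v′) = d₀` the set `{v′, U₁, …, U_r}` exhausts the places over `2` (★ B7
`forall_mem_of_sum_ramificationIdx_mul_inertiaDeg_eq_finrank_int`).  NEW (§2): at `Uᵢ`, `J′ᵢ α = E(c′ᵢ)` and `(E(c′ᵢ) − 1)∕4 = E((c′ᵢ − 1)∕4)` with
`(c′ᵢ − 1)∕4 ∈ ℤ₂`, so `v((J′ᵢ α − 1)∕4) ≤ 1` (a bicontinuous iso preserves the closed unit ball, §1 `valued_ringEquiv_le_one_iff`), whence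
`|(α − 1)∕4|_{Uᵢ} ≤ 1` by ★ P8d `valuation_sub_one_div_four_le_one_of_pinned`; a dyadic `u ≠ v′` is some `Uᵢ` by exhaustion.  §1 also records the local
read-back `4 ∣ c − 1 ∧ ‖c′ − c‖ < 1∕4 ⟹ 4 ∣ c′ − 1` that turns ★ B6's nearness `‖c′ᵢ − cᵢ‖ < ρ ≤ 1∕4` into `hc4`.

HONEST LABEL: C3 is a sub-brick of the GENUINE residual (U3-F) at `p = 2` and closes nothing alone; HC_CM is proved only modulo the 7 printed citations
(2 remaining named inputs: hLiu418 = stmt-HodgeConjecture-24832, h413 = stmt-HodgeConjecture-24833) until rung 0 closes; count-neutral helper.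
References: [NeukirchANT1999] Ch. II (8.1)–(8.5); [CasselsFrohlichANT1967] Ch. II §10 (10.2)–(10.3); [Serre1979] Ch. II §3.
-/

set_option autoImplicit false
-- the mandated namespace repeats the single-problem summit's segment (`HodgeConjecture.HodgeConjecture`)
set_option linter.dupNamespace false

noncomputable section

open Polynomial IntermediateField Topology Filter IsDedekindDomain NumberField Finset
open Literature.NumberTheory.NumberFields (finrank_padic_adicCompletion_eq')

namespace Summit.HodgeConjecture.HodgeConjecture.R90.S3

/-! ## §1 Service lemmas: the local read-back `4 ∣ c′ − 1`, the closed unit ball through a bicontinuous iso -/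

/-- **LOCAL DYADIC READ-BACK.**  If `c ≡ 1 (mod 4)` in `ℤ₂` and `‖c′ − c‖ < 1∕4` (★ B6 `exists_pow_planted_roots_near` at `ρ ≤ 1∕4`), then `c′ ≡ 1 (mod 4)`
(`‖c′ − c‖ ≤ 2^{−2}` ⟺ `c′ − c ∈ 4ℤ₂`, Mathlib `PadicInt.norm_le_pow_iff_mem_span_pow`). [cite: NeukirchANT1999, Ch. II (8.2)] -/
theorem four_dvd_sub_one_of_norm_sub_lt {c c' : ℤ_[2]} (hc : (4 : ℤ_[2]) ∣ c - 1) (h : ‖(c' : ℚ_[2]) - c‖ < 1 / 4) : (4 : ℤ_[2]) ∣ c' - 1 := by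
  have hle : ‖c' - c‖ ≤ (2 : ℝ) ^ (-(2 : ℕ) : ℤ) := by
    rw [PadicInt.norm_def, PadicInt.coe_sub]
    norm_num
    exact h.le
  have hmem := (PadicInt.norm_le_pow_iff_mem_span_pow (c' - c) 2).1 hle
  rw [Ideal.mem_span_singleton] at hmem
  have h4 : (4 : ℤ_[2]) ∣ c' - c := by norm_num at hmem; exact hmem
  have := h4.add hc
  rwa [sub_add_sub_cancel] at this

/-- **The closed unit ball through a bicontinuous iso `E : ℚ_p ≃ ℚ_{v₀}`**: `v(E x) ≤ 1 ⟺ ‖x‖ ≤ 1` (the `≤ 1` companion of ★ B7 `valued_ringEquiv_lt_one_iff`, read on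
inverses). [cite: Serre1979, Ch. II §3] -/
theorem valued_ringEquiv_le_one_iff (p : ℕ) [Fact p.Prime] (v₀ : HeightOneSpectrum (𝓞 ℚ)) (E : ℚ_[p] ≃+* v₀.adicCompletion ℚ) (hE : Continuous E)
    (hE' : Continuous E.symm) (x : ℚ_[p]) : Valued.v (E x) ≤ 1 ↔ ‖x‖ ≤ 1 := by
  by_cases hx : x = 0
  · subst hx; simp
  have hx' : E x ≠ 0 := (map_ne_zero E).2 hx
  have hv0 : 0 < Valued.v (E x) := zero_lt_iff.2 ((Valuation.ne_zero_iff _).2 hx')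
  have hn0 : 0 < ‖x‖ := norm_pos_iff.2 hx
  have hlt := valued_ringEquiv_lt_one_iff p v₀ E hE hE' x⁻¹
  rw [map_inv₀, map_inv₀, norm_inv, inv_lt_one₀ hv0, inv_lt_one₀ hn0] at hlt
  constructor
  · intro h; exact not_lt.1 fun h' => (not_lt.2 h) (hlt.2 h')
  · intro h; exact not_lt.1 fun h' => (not_lt.2 h) (hlt.1 h')

/-! ## §2 HEAD: the planted place, the unit clause, and `α ≡ 1 (mod 4)` at the dyadic places `≠ v′` -/

section Head

variable {L : Type} [Field L] [NumberField L] (w : HeightOneSpectrum (𝓞 L)) [Algebra ℚ_[2] (w.adicCompletion L)]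

/-- **C3 HEAD — THE PLANTED PLACE `v′`, `α ∉ 𝔭_u` FOR `u ≠ v′`, AND `|(α − 1)∕4|_u ≤ 1` AT EVERY DYADIC `u ≠ v′`** (the `p := 2` twin of ★ B7 `exists_plantedPlace`,
binder spine verbatim at `p := 2` plus `hc4`).  At `K = L_w` (`2 ∈ 𝔭_w`, continuous finite `ℚ₂`-structure) let `F` be a number field with `α ∈ 𝓞 F`,
`[F : ℚ] = [K : ℚ₂] + r`, `|N_{F∕ℚ}(α)| = 2^a`; `J₀ : F →+* K` with `J₀ α = β`, `ℚ₂⟮β⟯ = ⊤`, `v_w(β) < 1`; `J i : F →+* ℚ₂` with `J i α = c′ᵢ`, the `c′ᵢ ∈ ℤ₂^×`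
distinct units `≡ 1 (mod 4)`.  THEN `J₀` is dense and pins a place `v′ ∋ 2, α` of `F`; `α ∉ 𝔭_u` for EVERY `u ≠ v′` (★ B7's clause, the `hαu` of ★ P8c∕P8d);
AND for every DYADIC `u ≠ v′`: `u.valuation F ((α − 1)∕4) ≤ 1` (the `hα4` of ★ P8d `exists_planted_dyadic_data`, in its bytes).
[cite: NeukirchANT1999, Ch. II (8.1)-(8.5)] [cite: CasselsFrohlichANT1967, Ch. II §10 (10.2)-(10.3)] [cite: Serre1979, Ch. II §3] -/
theorem exists_plantedPlace_two (hw : ((2 : ℕ) : 𝓞 L) ∈ w.asIdeal) (hc : Continuous (algebraMap ℚ_[2] (w.adicCompletion L)))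
    {F : Type} [Field F] [NumberField F] (α : 𝓞 F) {r : ℕ} (hd : Module.finrank ℚ F = Module.finrank ℚ_[2] (w.adicCompletion L) + r)
    {a : ℕ} (hN : |Algebra.norm ℚ (α : F)| = (2 ^ a : ℕ))
    (J₀ : F →+* w.adicCompletion L) {β : w.adicCompletion L} (hJ₀α : J₀ (α : F) = β) (hβ : ℚ_[2]⟮β⟯ = ⊤) (hβ1 : Valued.v β < 1)
    (c' : Fin r → ℤ_[2]) (hcu : ∀ i, IsUnit (c' i)) (hci : Function.Injective c')
    (J : Fin r → (F →+* ℚ_[2])) (hJα : ∀ i, J i (α : F) = ((c' i : ℤ_[2]) : ℚ_[2])) (hc4 : ∀ i, (4 : ℤ_[2]) ∣ c' i - 1) :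
    DenseRange J₀ ∧ ∃ v' : HeightOneSpectrum (𝓞 F), (∀ x : 𝓞 F, x ∈ v'.asIdeal ↔ Valued.v (J₀ (x : F)) < 1) ∧
      ((2 : ℕ) : 𝓞 F) ∈ v'.asIdeal ∧ α ∈ v'.asIdeal ∧ (∀ u : HeightOneSpectrum (𝓞 F), u ≠ v' → α ∉ u.asIdeal) ∧
      ∀ u : HeightOneSpectrum (𝓞 F), u ≠ v' → (2 : 𝓞 F) ∈ u.asIdeal → u.valuation F ((((α : F)) - 1) / 4) ≤ 1 := by
  classical
  -- density of `J₀` (★ P2″ §3) and the pinned place `v′` (★ P1)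
  have hJ₀d : DenseRange J₀ := denseRange_of_adjoin_eq_top 2 hc hβ J₀ ⟨α, hJ₀α⟩
  obtain ⟨v', hv'pin, ψ, hψc, hψc', hψJ⟩ := exists_adicCompletion_ringEquiv_of_denseRange w J₀ hJ₀d
  have hαv' : α ∈ v'.asIdeal := (hv'pin α).2 (by rw [hJ₀α]; exact hβ1)
  have hpv' : ((2 : ℕ) : 𝓞 F) ∈ v'.asIdeal := (hv'pin _).2 (by
    rw [RingOfIntegers.coe_eq_algebraMap, map_natCast, map_natCast]; exact valued_natCast_lt_one_of_mem 2 w hw)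
  refine ⟨hJ₀d, v', hv'pin, hpv', hαv', ?_⟩
  -- LOCAL DEGREE of `v′`: `e′f′(v′) = [K : ℚ₂]` through the `ℚ₂`-structure transported along `ψ`
  have hdeg_v' : Ideal.ramificationIdx' (Ideal.span {((2 : ℕ) : ℤ)}) v'.asIdeal * Ideal.inertiaDeg' (Ideal.span {((2 : ℕ) : ℤ)}) v'.asIdeal =
      Module.finrank ℚ_[2] (w.adicCompletion L) := by
    letI alg : Algebra ℚ_[2] (v'.adicCompletion F) := (ψ.symm.toRingHom.comp (algebraMap ℚ_[2] (w.adicCompletion L))).toAlgebra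
    have hc' : Continuous (algebraMap ℚ_[2] (v'.adicCompletion F)) := hψc'.comp hc
    rw [← finrank_padic_adicCompletion_eq' 2 v' hpv' hc']
    refine Algebra.finrank_eq_of_equiv_equiv (RingEquiv.refl ℚ_[2]) ψ (RingHom.ext fun x => ?_)
    change algebraMap ℚ_[2] (w.adicCompletion L) x = ψ (ψ.symm (algebraMap ℚ_[2] (w.adicCompletion L) x))
    rw [ψ.apply_symm_apply]
  -- the `(2)`-adic place `v₀` of `ℚ` and `E : ℚ₂ ≃ ℚ_{v₀}`
  set v₀ : HeightOneSpectrum (𝓞 ℚ) := (Rat.HeightOneSpectrum.primesEquiv (R := 𝓞 ℚ)).symm ⟨2, Fact.out⟩ with hv₀def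
  have hv₀ : ((2 : ℕ) : 𝓞 ℚ) ∈ v₀.asIdeal := natCast_mem_primesEquiv_symm 2
  -- (pin the `ℚ`-algebra structure of `ℚ_{v₀}` to the one in the type of Mathlib's `Padic.adicCompletionEquiv`; all `ℚ`-algebra structures agree)
  letI instQv₀ : Algebra ℚ (v₀.adicCompletion ℚ) := HeightOneSpectrum.instAlgebraAdicCompletion (𝓞 ℚ) ℚ v₀
  let E₀ := Padic.adicCompletionEquiv (𝓞 ℚ) ⟨2, Fact.out⟩
  let E : ℚ_[2] ≃+* v₀.adicCompletion ℚ := E₀.toRingEquiv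
  have hEc : Continuous E := E₀.continuous
  have hEc' : Continuous E.symm := E₀.symm.continuous
  -- the embeddings `J′ i : F → ℚ_{v₀}`: dense, pinning places `U i ∋ 2` with `α ∉ 𝔭_{U i}`, local degree `1`, AND `|(α − 1)∕4|_{U i} ≤ 1`
  let J' : Fin r → (F →+* v₀.adicCompletion ℚ) := fun i => E.toRingHom.comp (J i)
  have hJ'apply : ∀ i (x : F), J' i x = E (J i x) := fun i x => rfl
  have hJ'd : ∀ i, DenseRange (J' i) := fun i => by
    refine Dense.mono ?_ (HeightOneSpectrum.denseRange_algebraMap ℚ v₀)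
    rintro _ ⟨q, rfl⟩
    refine ⟨(q : F), ?_⟩
    rw [hJ'apply, map_ratCast, map_ratCast]
    exact (eq_ratCast _ q).symm
  have hU : ∀ i, ∃ U : HeightOneSpectrum (𝓞 F), (∀ x : 𝓞 F, x ∈ U.asIdeal ↔ Valued.v (J' i (x : F)) < 1) ∧
      ((2 : ℕ) : 𝓞 F) ∈ U.asIdeal ∧ α ∉ U.asIdeal ∧
      Ideal.ramificationIdx' (Ideal.span {((2 : ℕ) : ℤ)}) U.asIdeal * Ideal.inertiaDeg' (Ideal.span {((2 : ℕ) : ℤ)}) U.asIdeal = 1 ∧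
      U.valuation F ((((α : F)) - 1) / 4) ≤ 1 := fun i => by
    obtain ⟨U, hUpin, ψU, hψUc, hψUc', -⟩ := exists_adicCompletion_ringEquiv_of_denseRange v₀ (J' i) (hJ'd i)
    have hpU : ((2 : ℕ) : 𝓞 F) ∈ U.asIdeal := (hUpin _).2 (by
      rw [RingOfIntegers.coe_eq_algebraMap, map_natCast, map_natCast]; exact valued_natCast_lt_one_of_mem 2 v₀ hv₀)
    refine ⟨U, hUpin, hpU, fun hαU => ?_, ?_, ?_⟩
    · -- `α ∉ 𝔭_U`: `v(E c′ᵢ) < 1 ⟺ ‖c′ᵢ‖ < 1`, false for a unit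
      have h1 := (hUpin α).1 hαU
      rw [hJ'apply, hJα, valued_ringEquiv_lt_one_iff 2 v₀ E hEc hEc', PadicInt.padic_norm_e_of_padicInt, PadicInt.isUnit_iff.1 (hcu i)] at h1
      exact lt_irrefl _ h1
    · -- local degree `1`: the `ℚ₂`-structure `ℚ₂ ≃ ℚ_{v₀} ≃ F_U`
      letI alg : Algebra ℚ_[2] (U.adicCompletion F) := (ψU.symm.toRingHom.comp E.toRingHom).toAlgebra
      have hcU : Continuous (algebraMap ℚ_[2] (U.adicCompletion F)) := hψUc'.comp hEc
      rw [finrank_padic_adicCompletion_eq' 2 U hpU hcU |>.symm, ← Module.finrank_self ℚ_[2]]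
      symm
      refine Algebra.finrank_eq_of_equiv_equiv (RingEquiv.refl ℚ_[2]) (E.trans ψU.symm) (RingHom.ext fun x => ?_)
      change ψU.symm (E x) = ψU.symm (E (algebraMap ℚ_[2] ℚ_[2] x))
      rw [Algebra.algebraMap_self, RingHom.id_apply]
    · -- NEW: `|(α − 1)∕4|_U ≤ 1` — `(J′ i α − 1)∕4 = E ((c′ᵢ − 1)∕4)` with `(c′ᵢ − 1)∕4 ∈ ℤ₂`
      obtain ⟨y, hy⟩ := hc4 i
      have h4c : ((4 : ℤ_[2]) : ℚ_[2]) = 4 := by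
        rw [show (4 : ℤ_[2]) = ((4 : ℕ) : ℤ_[2]) by norm_num, PadicInt.coe_natCast]; norm_num
      have hq : ((((c' i : ℤ_[2]) : ℚ_[2]) - 1) / 4) = ((y : ℤ_[2]) : ℚ_[2]) := by
        rw [div_eq_iff (by norm_num : (4 : ℚ_[2]) ≠ 0)]
        have hy' := congrArg ((↑) : ℤ_[2] → ℚ_[2]) hy
        rw [PadicInt.coe_sub, PadicInt.coe_one, PadicInt.coe_mul, h4c] at hy'
        rw [hy', mul_comm]
      have h4 : Valued.v ((J' i (α : F) - 1) / 4) ≤ 1 := by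
        have hE4 : (J' i (α : F) - 1) / 4 = E ((((c' i : ℤ_[2]) : ℚ_[2]) - 1) / 4) := by
          rw [hJ'apply, hJα, map_div₀, map_sub, map_one, map_ofNat]
        rw [hE4, hq, valued_ringEquiv_le_one_iff 2 v₀ E hEc hEc', PadicInt.padic_norm_e_of_padicInt]
        exact PadicInt.norm_le_one y
      exact valuation_sub_one_div_four_le_one_of_pinned v₀ (J' i) (hJ'd i) hUpin (α : F) h4
  choose U hUpin hpU hαU hdegU hU4 using hU
  -- the `U i` are pairwise distinct (★ P9′) and distinct from `v′`
  have hUinj : Function.Injective U := by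
    intro i j hij
    by_contra hne
    have hne' : J' i (α : F) ≠ J' j (α : F) := by
      rw [hJ'apply, hJ'apply, hJα, hJα]
      intro h
      exact hne (hci (PadicInt.ext (E.injective h)))
    obtain ⟨x, hx⟩ := exists_valued_apply_ne_of_apply_ne_rat F v₀ (J' i) (J' j) (α : F) hne'
    exact ne_of_valued_apply_ne F v₀ v₀ (J' i) (J' j) (hJ'd i) (hJ'd j) (hUpin i) (hUpin j) x hx hij
  have hv'U : ∀ i, v' ≠ U i := fun i h => hαU i (h ▸ hαv')
  -- EXHAUSTION: `T := {v′} ∪ {U i}` carries `Σ e′f′ = d₀ + r = [F : ℚ]`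
  set T : Finset (HeightOneSpectrum (𝓞 F)) := insert v' (Finset.univ.image U) with hT
  have hTp : ∀ u ∈ T, ((2 : ℕ) : 𝓞 F) ∈ u.asIdeal := by
    intro u hu
    rcases Finset.mem_insert.1 hu with rfl | hu
    · exact hpv'
    · obtain ⟨i, -, rfl⟩ := Finset.mem_image.1 hu
      exact hpU i
  have hv'nmem : v' ∉ Finset.univ.image U := by
    intro h
    obtain ⟨i, -, hi⟩ := Finset.mem_image.1 h
    exact hv'U i hi.symm
  have hsum : ∑ u ∈ T, Ideal.ramificationIdx' (Ideal.span {((2 : ℕ) : ℤ)}) u.asIdeal * Ideal.inertiaDeg' (Ideal.span {((2 : ℕ) : ℤ)}) u.asIdeal =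
      Module.finrank ℚ F := by
    rw [hT, Finset.sum_insert hv'nmem, Finset.sum_image fun i _ j _ h => hUinj h, hdeg_v', hd]
    simp only [hdegU, Finset.sum_const, Finset.card_univ, Fintype.card_fin, smul_eq_mul, mul_one]
  -- every place over `2` other than `v′` is some `U i`
  have hexh : ∀ u : HeightOneSpectrum (𝓞 F), u ≠ v' → ((2 : ℕ) : 𝓞 F) ∈ u.asIdeal → ∃ i, u = U i := by
    intro u hu hpu
    have huT := forall_mem_of_sum_ramificationIdx_mul_inertiaDeg_eq_finrank_int 2 T hTp hsum u hpu
    rcases Finset.mem_insert.1 huT with h | h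
    · exact absurd h hu
    · obtain ⟨i, -, rfl⟩ := Finset.mem_image.1 h
      exact ⟨i, rfl⟩
  refine ⟨fun u hu => ?_, fun u hu hu2 => ?_⟩
  · -- the unit clause
    by_cases hpu : ((2 : ℕ) : 𝓞 F) ∈ u.asIdeal
    · obtain ⟨i, rfl⟩ := hexh u hu hpu
      exact hαU i
    · exact not_mem_of_absNorm_eq_prime_pow_of_natCast_not_mem (Fact.out : (2 : ℕ).Prime) (absNorm_span_singleton_eq_of_abs_norm_eq α hN) u hpu
  · -- the dyadic clause
    have hpu : ((2 : ℕ) : 𝓞 F) ∈ u.asIdeal := by simpa using hu2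
    obtain ⟨i, rfl⟩ := hexh u hu hpu
    exact hU4 i

end Head

end Summit.HodgeConjecture.HodgeConjecture.R90.S3

end
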